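import Mathlib
import HarnessLib
import Literature.Analysis.FluidPDE.SpaceTimeRescaling
import Literature.Analysis.FluidPDE.LocalTypeIScaling

/-!
# StableStrataDoorHalfZoomRate — two bookkeeping lemmas for the prescribed-time zoom frame
# (SEED-26 input I1, door S26 «StableStrataDoor»; nsreg-p6 g14)

* `tendsto_prescribedScale` — the base scales `μₙ = 2√(ν(T−tₙ))/R` tend to `0` as `tₙ → T`;
* `halfZoom_spaceTimeRate` — the space–time local Type-I bound `‖u‖(‖x−x₀‖+√(ν(T−t))) ≤ M` passes to the half-zoom
  `v' = ½ v(·/4, ·/2)` of `v = (R/ν) u(T + (R²/ν)·, x₀ + R·)` as the rate `(max M 0/ν)/(‖y‖+√−s)` on `Q(1)`.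

WHAT THIS IS NOT: not NS regularity; plumbing for a compactness input of a criterion INSIDE the Type-I class.
-/

noncomputable section

set_option linter.dupNamespace false

namespace Summit.NavierStokesRegularity.NavierStokesRegularity.Theorems.StableStrataDoorHalfZoomRate

open MeasureTheory Set Function Filter Topology TopologicalSpace Metric
open Literature.Analysis Literature.Analysis.FluidPDE
open scoped NNReal ENNReal

/-- The prescribed base scales `μₙ = 2√(ν(T−tₙ))/R` tend to `0` as `tₙ → T`. -/
theorem tendsto_prescribedScale {ν T : ℝ} {t : ℕ → ℝ} (ht : Tendsto t atTop (𝓝 T)) (R : ℝ) :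
    Tendsto (fun n => 2 * Real.sqrt (ν * (T - t n)) / R) atTop (𝓝 0) := by
  have h1 : Tendsto (fun n => ν * (T - t n)) atTop (𝓝 (ν * (T - T))) :=
    (tendsto_const_nhds.sub ht).const_mul ν
  rw [sub_self, mul_zero] at h1
  have h2 := (Real.continuous_sqrt.tendsto 0).comp h1
  rw [Real.sqrt_zero] at h2
  have h3 := (h2.const_mul 2).div_const R
  rw [mul_zero, zero_div] at h3
  exact h3

/-- **The space–time local Type-I bound passes to the half-zoom** `v' = ½·v(·/4, ·/2)`, `v = α u(T + β·, x₀ + R·)`,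
`α = R/ν`, `β = R²/ν`, as the rate `(max M 0/ν)/(‖y‖ + √−s)` on `Q(1) = (−1,0) × B₁` (scale covariance of the weight
`‖x − x₀‖ + √(ν(T−t))`; the cylinder `Q(1)` of `v'` sits inside the physical region by `β ≤ T`, `β ≤ ρ²`, `R ≤ ρ`). -/
theorem halfZoom_spaceTimeRate {ν T R α β ρ M : ℝ} {u : ℝ → EuclideanSpace ℝ (Fin 3) → EuclideanSpace ℝ (Fin 3)}
    {x₀ : EuclideanSpace ℝ (Fin 3)} (hν : 0 < ν) (hR : 0 < R) (hα : 0 < α)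
    (hβR : β = R ^ 2 / ν) (hαR : α = R / ν) (hβT : β ≤ T) (hRρ : R ≤ ρ) (hβρ : β ≤ ρ ^ 2)
    (hM' : ∀ t ∈ Ico 0 T, T - ρ ^ 2 < t → ∀ x ∈ ball x₀ ρ, ‖u t x‖ * (‖x - x₀‖ + Real.sqrt (ν * (T - t))) ≤ M) :
    ∀ s ∈ Ioo (-(1 : ℝ) ^ 2) 0, ∀ y ∈ ball (0 : EuclideanSpace ℝ (Fin 3)) 1,
      ‖((1 / 2 : ℝ) • stPull ((1 / 2 : ℝ) ^ 2) (1 / 2) (0 : ℝ) (0 : EuclideanSpace ℝ (Fin 3))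
          (α • stPull β R T x₀ u)) s y‖ ≤ (max M 0 / ν) / (‖y‖ + Real.sqrt (-s)) := by
  have hβ : 0 < β := by rw [hβR]; positivity
  intro s hs y hy
  rw [one_pow] at hs
  rw [mem_ball_zero_iff] at hy
  have hs0 : 0 < -s := by linarith [hs.2]
  -- the physical point
  set t' : ℝ := T + β * ((1 / 2 : ℝ) ^ 2 * s) with ht'
  set x : EuclideanSpace ℝ (Fin 3) := x₀ + R • ((1 / 2 : ℝ) • y) with hx
  have hβs : β * ((1 / 2 : ℝ) ^ 2 * s) < 0 := by nlinarith
  have hβs' : -(β * ((1 / 2 : ℝ) ^ 2 * s)) ≤ β := by nlinarith [hs.1]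
  have ht'mem : t' ∈ Ico 0 T := ⟨by rw [ht']; linarith, by rw [ht']; linarith⟩
  have ht'lt : T - ρ ^ 2 < t' := by rw [ht']; nlinarith [hs.1]
  have hxmem : x ∈ ball x₀ ρ := by
    rw [mem_ball, hx, dist_eq_norm, add_sub_cancel_left, norm_smul, norm_smul, Real.norm_eq_abs,
      Real.norm_eq_abs, abs_of_pos hR, abs_of_pos (by norm_num : (0 : ℝ) < 1 / 2)]
    nlinarith
  have hkey := hM' t' ht'mem ht'lt x hxmem
  -- the weights: `‖x - x₀‖ + √(ν (T - t')) = (R/2) (‖y‖ + √(-s))`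
  have hw : ‖x - x₀‖ + Real.sqrt (ν * (T - t')) = (R / 2) * (‖y‖ + Real.sqrt (-s)) := by
    have e1 : ‖x - x₀‖ = (R / 2) * ‖y‖ := by
      rw [hx, add_sub_cancel_left, norm_smul, norm_smul, Real.norm_eq_abs, Real.norm_eq_abs, abs_of_pos hR,
        abs_of_pos (by norm_num : (0 : ℝ) < 1 / 2)]
      ring
    have e2 : ν * (T - t') = (R / 2) ^ 2 * (-s) := by
      rw [ht', hβR]; field_simp; ring
    rw [e1, e2, Real.sqrt_mul (by positivity), Real.sqrt_sq (by positivity)]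
    ring
  rw [hw] at hkey
  have hpos : 0 < ‖y‖ + Real.sqrt (-s) := by positivity
  have hu : ‖u t' x‖ ≤ max M 0 / ((R / 2) * (‖y‖ + Real.sqrt (-s))) := by
    rw [le_div_iff₀ (by positivity)]
    exact hkey.trans (le_max_left _ _)
  -- `v' s y = (α/2) u(t', x)`
  have hv'eq : ((1 / 2 : ℝ) • stPull ((1 / 2 : ℝ) ^ 2) (1 / 2) (0 : ℝ) (0 : EuclideanSpace ℝ (Fin 3))
      (α • stPull β R T x₀ u)) s y = ((1 / 2 : ℝ) * α) • u t' x := by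
    rw [smul_stPull_apply, smul_stPull_apply, smul_smul]
    simp only [zero_add, ht', hx]
  rw [hv'eq, norm_smul, Real.norm_eq_abs, abs_of_pos (by positivity)]
  calc (1 / 2 : ℝ) * α * ‖u t' x‖ ≤ (1 / 2 : ℝ) * α * (max M 0 / ((R / 2) * (‖y‖ + Real.sqrt (-s)))) :=
        mul_le_mul_of_nonneg_left hu (by positivity)
    _ = (max M 0 / ν) / (‖y‖ + Real.sqrt (-s)) := by
        rw [hαR]; field_simp


end Summit.NavierStokesRegularity.NavierStokesRegularity.Theorems.StableStrataDoorHalfZoomRate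

end
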